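import Literature.MathematicalPhysics.QuantumFieldTheory.Balaban1983to89.B9Eq333ProjectionCovarianceZd
import Literature.MathematicalPhysics.QuantumFieldTheory.Balaban1983to89.B9Eq332AveragingLetterCovarianceZdLevelZero
import Literature.MathematicalPhysics.QuantumFieldTheory.Balaban1983to89.B9SupplySockB9P3ZdAllLettersZd

/-!
# `Balaban1983to89.B9Eq334GaugeCovarianceZd` — [Balaban1985BackgroundPropagators] (3.31)–(3.34) pp. 395–396 AT THE `ℤᵈ × 𝔸` CARRIER OF THE J-N06→N05
# JUNCTION: `Δ_a(U₀^u)(R(u)A) = R(u)Δ_a(U₀)A` for the four-letter `Δ_a = deltaAOf` of ANY letter record whose co-letters are covariant (PROVED for `D*D`,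
# `Δ′ = DpZd`, `D R(U₀) 𝟙D* = opsLandau`, and — companion file — n06-b's `Q*aQ = QQZdP`), `RegularAt` (Theorem 3.11's qualitative conclusion) is constant on gauge orbits,
# ★★★ `G(U₀^u)(R(u)J) = R(u)G(U₀)J` for dag-n06-w4's `G(U₀) = gopZd` ((3.34)), and the pairing `⟨A, Δ_a(U₀)A⟩_τ` — hence positive-definiteness — is an
# orbit property (the transport half of the per-member Theorem-3.11 road)

statement-level skeleton of published theorems with citation tags; proofs where landed; nothing here is a claim about the
Yang–Mills mass gap

T. Bałaban, *Propagators for lattice gauge theories in a background field*, Commun. Math. Phys. **99** (1985) 389–434 [`Balaban1985BackgroundPropagators`,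
"B9"], journal page = PDF page + 388.  THE PRINT (verbatim).  p. 395: *«⟨R(u)A, J^u⟩ = ⟨A, J⟩, ⟨R(u)A, Δ^η(U^u)R(u)A⟩ = ⟨A, Δ^η(U)A⟩, (3.30) or J^u = R(u)J,
Δ^η(U^u) = R(u)Δ^η(U)R(u⁻¹). We have a similar situation for the other operators. For the covariant Laplace operator (3.23) we have … Δ^η_{U^u} =
R(u)Δ^η_UR(u⁻¹). (3.31) … and Q′\*(U^u)aQ′(U^u) = R(u)Q′\*(U)aQ′(U)R(u⁻¹)»*; p. 396: *«The equalities (3.31), (3.32) imply further G′(U^u) = R(u)G′(U)R(u⁻¹),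
R(U^u) = R(u)R(U)R(u⁻¹). (3.33) Finally inspecting the definitions of the averaging operators Q_j(U) for gauge fields we can see that the equalities (3.32)
hold again. This implies the transformation laws for the operators Δ_a and G: Δ_a(U^u) = R(u)Δ_a(U)R(u⁻¹), G(U^u) = R(u)G(U)R(u⁻¹). (3.34)»*; p. 396
(3.35)–(3.36): *«there exists a gauge transformation u defined on □ … such that U^u = e^{iηA}»* — the class is a statement about the orbit; p. 416 Theorem
3.11: *«Let us assume that U satisfies the condition (3.35). Then the operators Δ′_a, G′, (Q′G′²Q′\*)⁻¹, Δ_a, G are positive definite»*.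

CITATION HEADER ∕ WHY THIS FILE (cell `pub-ymgap`, HUMAN RULING D-0062 ∕ D-0149; width seat `pub-ymgap-dag-n06-w3` (g3), node N06 = [B9]).  The binder
owner dag-n06-b g18 (bus 2026-08-28 03:54Z) named, after landing Theorem 3.11 AT THE FLAT BACKGROUND for the genuine four-letter record
(`B9Thm311FlatHermKernelZd.flat_posDef_herm_cube`), the two structural inputs the per-member Theorem-3.11 road still needs: (ii) continuity of the letters in
`U₀` (dag-n06-w4 g3, `B9Thm311PosDefOpenZd`) and (iii) **gauge covariance of `deltaAOf (opsAllZd …)`** — THIS FILE (with its companion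
`B9Eq333ProjectionCovarianceZd` for (3.32)∕(3.33)).  It is also the gauge-reduction step of Theorem 3.3's proof (every norm (3.41)–(3.47) is gauge
invariant, p. 398; the class (3.35) is an orbit condition — tree: `B9SupplySockB9P3ZdInstance.reg335_bgZd_gaugeAct`), at the `ℤᵈ` carrier where dag-n06-w4
built `G(U₀)` as an OBJECT.  INPUTS BY NAME: dag-n05-w3 `B8Ineq159GaugeCovariance.Jcur_gaugeAct ∕ covDivB_gaugeAct`, `B9Eq340HolderZd.covDerivFwd_gaugeAct`,
dag-n06-w2 `B9SupplySockB9P3ZdGammaInAkDpZd.DpZd_gaugeAct`, dag-n06-w4 `B9Eq321LandauProjectionZd` (`projR ∕ opsLandau`), `B9Eq327GreenZd` (`domSub ∕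
deltaADom ∕ RegularAt ∕ deltaAEquiv ∕ gopZd ∕ bondPair`), `B9SupplySockB9P3ZdAllLettersZd.opsAllZd`, and the companion's `rotS ∕ projR_gaugeAct ∕
re_trace_conj_pair ∕ gaugeAct_inv_gaugeAct`.

WHAT IS DECLARED ∕ PROVED (kernel, 0 sorry; three definitions with bodies — `R(u)` on bond fields ∕ on `E(Ω₀)` and the covariance PREDICATE of a
letter — and theorems; no `instance`, no `notation`).  `u : ℤᵈ → 𝔸ˣ` unitary-valued where stated, `U₀` ANY background of units, `τ` tracial (and
Hermitian faithful on a finite-dimensional fibre where `R(U₀)` is the projection).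
* §1 `rotB u` (`(R(u)A)(⟨z, z+e_κ⟩) = R(u(z))A(⟨z, z+e_κ⟩)`, (3.28)), `rotB_apply`, `rotB_inv_rotB ∕ rotB_rotB_inv`, `rotB_mem_domSub` (`R(u)E(Ω₀) ⊂ E(Ω₀)`),
  `restrictDom_rotB` (`𝟙_{Ω₀}` commutes with `R(u)`), `rotD u Ω₀` (restriction to `E(Ω₀)`), `coe_rotD`, `rotD_inv_rotD ∕ rotD_rotD_inv`, ★ `bondPair_rotB`
  (`⟨R(u)A, R(u)J⟩_τ = ⟨A, J⟩_τ`, (3.30)).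
* §2 `LetterCovAt T U₀ u` (Prop: `T(U₀^u)(R(u)A) = R(u)T(U₀)A` for all `A` — the printed shape (3.31)); ★ `letterCovAt_Jcur` (`D*_UD_U`, dag-n05-w3),
  ★ `letterCovAt_DpZd` (`Δ′`, dag-n06-w2), ★★ `letterCovAt_opsLandau_DRDs` (`D R(U₀) 𝟙_{Ω₀} D*`, finite `Ω₀`, from the companion's (3.33)), ★★
  `letterCovAt_deltaAOf` ((3.34) first half for ANY record from its three co-letters).
* §3 (3.34): `deltaADom_gaugeAct`, ★ `regularAt_gaugeAct` (Theorem 3.11's qualitative conclusion moves along the orbit), `regularAt_gaugeAct_iff`, ★★★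
  `gopZd_gaugeAct` (`G(U₀^u)(R(u)J) = R(u)(G(U₀)J)` — in the regime by uniqueness of the inverse, outside it both sides are `0`), ★ `bondPair_deltaAOf_gaugeAct`
  (`⟨R(u)A, Δ_a(U₀^u)R(u)A⟩_τ = ⟨A, Δ_a(U₀)A⟩_τ`), ★★ `posDef_gaugeAct` (positive-definiteness of `Δ_a` on `E(Ω₀)` passes from `U₀` to `U₀^u`).
* §4 the genuine record `opsAllZd τ L ΛbP ops₀` at a member with finite `Ω₀`, ALL FOUR LETTERS: ★ `letterCovAt_QQZdP` (the companion
  `B9Eq332AveragingLetterCovarianceZdLevelZero.QQZdP_gaugeAct₀` — n06-b's EDITION P letter — in this currency; unitary `U₀`, `2 ≤ L`, the class's BOX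
  clause at the levels `1 ≤ j` only, so print's class `cubeLamBP` is admitted),
  ★★ `letterCovAt_deltaAOf_opsAllZd` (+ `…_of_reg17Univ`: NO box clause, `U₀` in the class (1.7) on `Ω ≡ ℤᵈ`), ★★★ `gop_opsAllZd_gaugeAct`,
  `regularAt_opsAllZd_gaugeAct_iff`, `posDef_opsAllZd_gaugeAct`.

HONEST SCOPE.  Conjugation algebra and linear algebra on landed objects (the `Q*aQ` clause of (3.32) is the companion file's `QQZdP_gaugeAct`, under print's
regime hypotheses: unitary `U₀`, the box law of the averaging class); no estimate of [B9]; Theorems 3.3 ∕ 3.11 at curved `U₀` NOT proved; count-neutral; N05 ∕ N06 NOT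
discharged; K1⁷ `stmt-QuantumFields-20542` NOT closed; one finite `𝕋⁴` programme at fixed `ε`, Bałaban as printed; R4 closes only the conditional finite-`𝕋⁴`
rung `BalabanLadder.UV` — nothing continuum ∕ ℝ⁴ ∕ OS ∕ mass gap ∕ Clay.  Unit `pub-ymgap-dag-n06-w3` (g3), 2026-08-28.
-/

noncomputable section

namespace Literature.MathematicalPhysics.QuantumFieldTheory.Balaban1983to89.B9Eq334GaugeCovarianceZd

open B7Prop1Explicit B7Eq78Linearization
open B7Prop2Explicit (unitaryUnits)
open B8Ineq132 (BondTouches conjR_conjR conjR_sum one_conjR)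
open B8Eq155JBound (Jcur)
open B8Eq138LandauZd (covDivB covLap)
open B8Ineq159GaugeCovariance (Jcur_gaugeAct covDivB_gaugeAct)
open B9Eq340HolderZd (covDerivFwd_gaugeAct)
open B8LeafModelZd (ZdIdx)
open B9SupplySockB9P3ZdLetters (OpsZd deltaAOf)
open B9SupplySockB9P3ZdLettersOmega (restrictDom restrictDom_of restrictDom_of_not)
open B9Eq321LandauProjectionZd (projR opsLandau opsLandau_DRDs_of_finite)
open B9Eq327GreenZd
open B9SupplySockB9P3ZdGammaInAkDpZd (withDpZd DpZd_gaugeAct)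
open B9Eq369CurvSmallZd (DpZd)
open B9Eq316AveragingTransposeZdPrinted (withQQP QQZdP)
open B9SupplySockB9P3ZdAllLettersZd (opsAllZd opsAllZd_Dp opsAllZd_QQ opsAllZd_DRDs opsAllZd_Gop)
open B9Eq332AvgCovariance (conjR_inv_conjR)
open B7Prop1Local (InBox loK bondHiK)
open B9Eq332AveragingLetterCovarianceZdLevelZero (QQZdP_gaugeAct₀)
open B9Eq333ProjectionCovarianceZd

-- `Site` alone could resolve to the torus sites of `Setup.lean`; re-export the `ℤ^d` sites of `B7Prop1Explicit`.
export B7Prop1Explicit (Site)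

variable {d : ℕ} {𝔸 : Type*} [CStarAlgebra 𝔸]

/-! ## §1  `R(u)` on bond fields and on `E(Ω₀)`; the bond pairing is `R(u)`-invariant -/

section Rotation

variable (u : Site d → 𝔸ˣ)

/-- **`R(u)` ON BOND FIELDS** ((3.28): `(R(u)A)(x, x′) = R(u(x))A(x, x′)` for the bond `⟨x, x + e_κ⟩`), as an ℝ-linear map — dag-n05-w3's rotation
`fun z κ => conjR (u z) (A z κ)` packaged. [cite: Balaban1985BackgroundPropagators, (3.28) p.395] -/
def rotB : (Site d → Fin d → 𝔸) →ₗ[ℝ] (Site d → Fin d → 𝔸) where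
  toFun A := fun z κ => conjR (u z) (A z κ)
  map_add' A B := by
    funext z κ
    exact conjR_add _ _ _
  map_smul' c A := by
    funext z κ
    exact conjR_smul_real _ _ _

/-- `R(u)` on bond fields, unfolded. [cite: Balaban1985BackgroundPropagators, (3.28) p.395 (bookkeeping)] -/
theorem rotB_apply (A : Site d → Fin d → 𝔸) (z : Site d) (κ : Fin d) : rotB u A z κ = conjR (u z) (A z κ) := rfl

/-- `R(u⁻¹)R(u) = id` on bond fields. [cite: Balaban1985BackgroundPropagators, (3.28) p.395 (bookkeeping)] -/
theorem rotB_inv_rotB (A : Site d → Fin d → 𝔸) : rotB u⁻¹ (rotB u A) = A := by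
  funext z κ
  exact conjR_inv_conjR (u z) (A z κ)

/-- `R(u)R(u⁻¹) = id` on bond fields. [cite: Balaban1985BackgroundPropagators, (3.28) p.395 (bookkeeping)] -/
theorem rotB_rotB_inv (A : Site d → Fin d → 𝔸) : rotB u (rotB u⁻¹ A) = A := by
  have h := rotB_inv_rotB u⁻¹ A
  rwa [inv_inv] at h

/-- **`R(u)E(Ω₀) ⊂ E(Ω₀)`** (the support condition is pointwise). [cite: Balaban1985BackgroundPropagators, (3.27) p.395 (bookkeeping)] -/
theorem rotB_mem_domSub {Ω₀ : Set (Site d)} {A : Site d → Fin d → 𝔸} (hA : A ∈ domSub (𝔸 := 𝔸) Ω₀) : rotB u A ∈ domSub (𝔸 := 𝔸) Ω₀ := by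
  intro y τ h
  rw [rotB_apply, hA y τ h, conjR_apply, mul_zero, zero_mul]

/-- **`𝟙_{Ω₀}` COMMUTES WITH `R(u)`**. [cite: Balaban1985BackgroundPropagators, (3.27) p.395 («Ω₀Δ_aΩ₀», bookkeeping)] -/
theorem restrictDom_rotB (Ω₀ : Set (Site d)) (A : Site d → Fin d → 𝔸) : restrictDom Ω₀ (rotB u A) = rotB u (restrictDom Ω₀ A) := by
  funext y τ
  by_cases h : BondTouches Ω₀ y τ
  · rw [restrictDom_of _ h, rotB_apply, rotB_apply, restrictDom_of _ h]
  · rw [restrictDom_of_not _ h, rotB_apply, restrictDom_of_not _ h, conjR_apply, mul_zero, zero_mul]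

/-- **`R(u)` ON `E(Ω₀)`** (the restriction of `rotB u`). [cite: Balaban1985BackgroundPropagators, (3.28), (3.27) p.395] -/
def rotD (Ω₀ : Set (Site d)) : domSub (𝔸 := 𝔸) Ω₀ →ₗ[ℝ] domSub (𝔸 := 𝔸) Ω₀ :=
  (rotB u).restrict fun _ hA => rotB_mem_domSub u hA

/-- `rotD`, read back as a bond field. [cite: Balaban1985BackgroundPropagators, (3.28) p.395 (bookkeeping)] -/
theorem coe_rotD (Ω₀ : Set (Site d)) (A : domSub (𝔸 := 𝔸) Ω₀) : (rotD u Ω₀ A : Site d → Fin d → 𝔸) = rotB u (A : Site d → Fin d → 𝔸) := rfl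

/-- `R(u⁻¹)R(u) = id` on `E(Ω₀)`. [cite: Balaban1985BackgroundPropagators, (3.28) p.395 (bookkeeping)] -/
theorem rotD_inv_rotD (Ω₀ : Set (Site d)) (A : domSub (𝔸 := 𝔸) Ω₀) : rotD u⁻¹ Ω₀ (rotD u Ω₀ A) = A :=
  Subtype.ext (rotB_inv_rotB u (A : Site d → Fin d → 𝔸))

/-- `R(u)R(u⁻¹) = id` on `E(Ω₀)`. [cite: Balaban1985BackgroundPropagators, (3.28) p.395 (bookkeeping)] -/
theorem rotD_rotD_inv (Ω₀ : Set (Site d)) (A : domSub (𝔸 := 𝔸) Ω₀) : rotD u Ω₀ (rotD u⁻¹ Ω₀ A) = A :=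
  Subtype.ext (rotB_rotB_inv u (A : Site d → Fin d → 𝔸))

/-- `rotD u` is a bijection of `E(Ω₀)` (inverse `rotD u⁻¹`). [cite: Balaban1985BackgroundPropagators, (3.28) p.395 (bookkeeping)] -/
theorem rotD_bijective (Ω₀ : Set (Site d)) : Function.Bijective (rotD (𝔸 := 𝔸) u Ω₀) :=
  ⟨fun A B h => by rw [← rotD_inv_rotD u Ω₀ A, ← rotD_inv_rotD u Ω₀ B, h],
    fun B => ⟨rotD u⁻¹ Ω₀ B, rotD_rotD_inv u Ω₀ B⟩⟩

/-- ★ **THE BOND PAIRING IS `R(u)`-INVARIANT**: `⟨R(u)A, R(u)J⟩_τ = ⟨A, J⟩_τ` for unitary `u` and tracial `τ` ((3.30) «⟨R(u)A, J^u⟩ = ⟨A, J⟩»).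
[cite: Balaban1985BackgroundPropagators, (3.30) p.395, (3.17) p.393] -/
theorem bondPair_rotB (τ : 𝔸 →ₗ[ℂ] ℂ) (hτt : ∀ a b : 𝔸, τ (a * b) = τ (b * a)) (hu : ∀ z, u z ∈ unitaryUnits 𝔸) (A J : Site d → Fin d → 𝔸) :
    bondPair τ (rotB u A) (rotB u J) = bondPair τ A J := by
  unfold bondPair
  refine Finset.sum_congr rfl fun μ _ => finsum_congr fun x => ?_
  rw [rotB_apply, rotB_apply]
  exact re_trace_conj_pair τ hτt (hu x) _ _

end Rotation

/-! ## §2  The covariance predicate of a letter; `D*D`, `Δ′`, `D R(U₀) 𝟙D*` are covariant; hence `Δ_a` -/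

section Letters

variable (u : Site d → 𝔸ˣ) (U₀ : Site d → Fin d → 𝔸ˣ)

/-- **THE PRINTED SHAPE (3.31) FOR A LETTER `T(U₀)`** at the pair `(U₀, u)`: `T(U₀^u)(R(u)A) = R(u)(T(U₀)A)` for every bond field `A` (as an equation of bond
fields).  A predicate on the letter — the letters of print satisfy it ((3.30)–(3.32)). [cite: Balaban1985BackgroundPropagators, (3.31) p.395, (3.34) p.396] -/
def LetterCovAt (T : (Site d → Fin d → 𝔸ˣ) → (Site d → Fin d → 𝔸) → Site d → Fin d → 𝔸) (U₀ : Site d → Fin d → 𝔸ˣ) (u : Site d → 𝔸ˣ) : Prop :=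
  ∀ A : Site d → Fin d → 𝔸, T (gaugeAct u U₀) (rotB u A) = rotB u (T U₀ A)

/-- ★ **`J_{U₀} = D*_{U₀}D_{U₀}` IS COVARIANT** ((3.30) «J^u = R(u)J»; dag-n05-w3's `Jcur_gaugeAct`), every `u`, every `U₀`.
[cite: Balaban1985BackgroundPropagators, (3.30) p.395; Balaban1985RegularSpaces, (1.55) p.86] -/
theorem letterCovAt_Jcur (η : ℝ) : LetterCovAt (fun (U : Site d → Fin d → 𝔸ˣ) (A : Site d → Fin d → 𝔸) (x : Site d) (μ : Fin d) => Jcur η U A μ x) U₀ u := by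
  intro A
  funext x μ
  exact Jcur_gaugeAct η u U₀ A μ x

/-- ★ **`Δ′(U₀)` IS COVARIANT** (dag-n06-w2's `DpZd_gaugeAct`; `B9Eq39Adjoint.R` and `conjR` are the same conjugation), every `u`, every `U₀`.
[cite: Balaban1985BackgroundPropagators, (3.28)–(3.30) p.395, (3.10) p.392] -/
theorem letterCovAt_DpZd (η : ℝ) : LetterCovAt (DpZd (𝔸 := 𝔸) η) U₀ u := by
  intro A
  funext x μ
  exact DpZd_gaugeAct η u U₀ A x μ

variable {u}

/-- ★★ **`D R(U₀) 𝟙_{Ω₀} D*` IS COVARIANT** for dag-n06-w4's `opsLandau` at a member with finite `Ω₀` — `D*` and `D` by dag-n05-w3's lemmas, `R(U₀)` by the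
companion's (3.33) `projR_gaugeAct` (`τ` tracial, Hermitian, faithful on a finite-dimensional fibre; `u` unitary; EVERY `U₀`).
[cite: Balaban1985BackgroundPropagators, (3.33) p.396, (3.26) p.395, (3.20)–(3.22) p.394] -/
theorem letterCovAt_opsLandau_DRDs [FiniteDimensional ℝ 𝔸] {L : ℕ} (τ : 𝔸 →ₗ[ℂ] ℂ) (hτt : ∀ a b : 𝔸, τ (a * b) = τ (b * a))
    (hτs : ∀ a : 𝔸, τ (star a) = starRingEnd ℂ (τ a)) (hτp : ∀ a : 𝔸, a ≠ 0 → 0 < (τ (star a * a)).re)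
    (hu : ∀ z, u z ∈ unitaryUnits 𝔸) (ops₀ : ℝ → ZdIdx d L → ℕ → OpsZd d 𝔸) (M : ℝ) (i : ZdIdx d L) (m : ℕ) (hΩ : (i.Ω 0).Finite) :
    LetterCovAt (opsLandau τ ops₀ M i m).DRDs U₀ u := by
  intro A
  funext x μ
  rw [opsLandau_DRDs_of_finite τ ops₀ M i m hΩ, rotB_apply, opsLandau_DRDs_of_finite τ ops₀ M i m hΩ]
  have hdiv : covDivB i.η (gaugeAct u U₀) (rotB u A) = fun z => conjR (u z) (covDivB i.η U₀ A z) :=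
    funext fun z => covDivB_gaugeAct i.η u U₀ A z
  rw [hdiv, projR_gaugeAct τ hΩ.toFinset L m i.η (i.Λs m) u U₀ hτt hτs hτp hu]
  exact covDerivFwd_gaugeAct i.η u U₀ μ (F := projR τ hΩ.toFinset L m i.η (i.Λs m) U₀ (covDivB i.η U₀ A)) (fun z => rfl) x

variable (u)

/-- ★★ **(3.34), FIRST HALF, FOR ANY RECORD: `Δ_a(U₀^u)(R(u)A) = R(u)Δ_a(U₀)A`** whenever the three co-letters `Δ′ ∕ DRD* ∕ Q*aQ` of the record are covariant at
`(U₀, u)` (the `D*D` term always is). [cite: Balaban1985BackgroundPropagators, (3.34) p.396, (3.26) p.395] -/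
theorem letterCovAt_deltaAOf (η : ℝ) (o : OpsZd d 𝔸) (hDp : LetterCovAt o.Dp U₀ u) (hDRDs : LetterCovAt o.DRDs U₀ u) (hQQ : LetterCovAt o.QQ U₀ u) :
    LetterCovAt (deltaAOf η o) U₀ u := by
  intro A
  funext x μ
  show Jcur η (gaugeAct u U₀) (rotB u A) μ x + o.Dp (gaugeAct u U₀) (rotB u A) x μ + o.DRDs (gaugeAct u U₀) (rotB u A) x μ +
      o.QQ (gaugeAct u U₀) (rotB u A) x μ =
    conjR (u x) (Jcur η U₀ A μ x + o.Dp U₀ A x μ + o.DRDs U₀ A x μ + o.QQ U₀ A x μ)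
  rw [hDp A, hDRDs A, hQQ A, rotB_apply, rotB_apply, rotB_apply, conjR_add, conjR_add, conjR_add]
  congr 1
  congr 1
  congr 1
  exact Jcur_gaugeAct η u U₀ A μ x

end Letters

/-! ## §3  (3.34): `RegularAt` along the orbit, `G(U₀^u)R(u) = R(u)G(U₀)`, and the pairing `⟨A, Δ_aA⟩_τ` is an orbit property -/

section Green

variable (η : ℝ) (o : OpsZd d 𝔸) (Ω₀ : Set (Site d)) {u : Site d → 𝔸ˣ} {U₀ : Site d → Fin d → 𝔸ˣ}

/-- `Δ_a↾Ω₀` is covariant when `Δ_a` is. [cite: Balaban1985BackgroundPropagators, (3.34) p.396, (3.27) p.395] -/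
theorem deltaADom_gaugeAct (h : LetterCovAt (deltaAOf η o) U₀ u) (A : Site d → Fin d → 𝔸) :
    deltaADom η o Ω₀ (gaugeAct u U₀) (rotB u A) = rotB u (deltaADom η o Ω₀ U₀ A) := by
  rw [deltaADom, deltaADom, h A, restrictDom_rotB]

/-- ★ **`RegularAt` MOVES ALONG THE ORBIT**: if `Δ_a(U₀)↾Ω₀` is an invertible operator of `E(Ω₀)` and `Δ_a` is covariant at `(U₀, u)`, then `Δ_a(U₀^u)↾Ω₀`
is invertible too (conjugate the operator by `R(u)`). [cite: Balaban1985BackgroundPropagators, (3.34) p.396, Thm 3.11 p.416, (3.35)–(3.36) p.396] -/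
theorem regularAt_gaugeAct (h : LetterCovAt (deltaAOf η o) U₀ u) (hr : RegularAt η o Ω₀ U₀) : RegularAt η o Ω₀ (gaugeAct u U₀) := by
  obtain ⟨Φ, hΦ, hbij⟩ := hr
  refine ⟨(rotD u Ω₀).comp (Φ.comp (rotD u⁻¹ Ω₀)), fun A => ?_, ?_⟩
  · rw [LinearMap.comp_apply, LinearMap.comp_apply, coe_rotD, hΦ, coe_rotD, ← deltaADom_gaugeAct η o Ω₀ h, rotB_rotB_inv]
  · exact (rotD_bijective u Ω₀).comp (hbij.comp (rotD_bijective u⁻¹ Ω₀))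

/-- `RegularAt` is CONSTANT on the orbit when `Δ_a` is covariant at `(U₀, u)` and at `(U₀^u, u⁻¹)`. [cite: Balaban1985BackgroundPropagators, (3.34) p.396, Thm 3.11 p.416] -/
theorem regularAt_gaugeAct_iff (h : LetterCovAt (deltaAOf η o) U₀ u) (h' : LetterCovAt (deltaAOf η o) (gaugeAct u U₀) u⁻¹) :
    RegularAt η o Ω₀ (gaugeAct u U₀) ↔ RegularAt η o Ω₀ U₀ := by
  refine ⟨fun hr => ?_, regularAt_gaugeAct η o Ω₀ h⟩
  have h1 := regularAt_gaugeAct η o Ω₀ h' hr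
  rwa [gaugeAct_inv_gaugeAct] at h1

/-- ★★★ **(3.34): `G(U₀^u)(R(u)J) = R(u)(G(U₀)J)`** for dag-n06-w4's `G(U₀) = gopZd η o Ω₀ U₀ = (Ω₀Δ_a(U₀)Ω₀)⁻¹` over ANY record whose `Δ_a` is covariant at
`(U₀, u)` and `(U₀^u, u⁻¹)`: in Theorem 3.11's regime `R(u)(G(U₀)J)` solves `Δ_a(U₀^u)↾Ω₀ (·) = 𝟙_{Ω₀}R(u)J` and the inverse is unique; outside the regime
(which is the same for `U₀` and `U₀^u`) both sides are `0`. [cite: Balaban1985BackgroundPropagators, (3.34) p.396, (3.27) p.395] -/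
theorem gopZd_gaugeAct (h : LetterCovAt (deltaAOf η o) U₀ u) (h' : LetterCovAt (deltaAOf η o) (gaugeAct u U₀) u⁻¹) (J : Site d → Fin d → 𝔸) :
    gopZd η o Ω₀ (gaugeAct u U₀) (rotB u J) = rotB u (gopZd η o Ω₀ U₀ J) := by
  by_cases hr : RegularAt η o Ω₀ U₀
  · have hr' : RegularAt η o Ω₀ (gaugeAct u U₀) := regularAt_gaugeAct η o Ω₀ h hr
    rw [gopZd_of_regularAt η o Ω₀ _ hr', gopZd_of_regularAt η o Ω₀ _ hr]
    set B := (deltaAEquiv η o Ω₀ U₀ hr).symm (restrictLin Ω₀ J) with hB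
    have hB' : deltaAEquiv η o Ω₀ U₀ hr B = restrictLin Ω₀ J := by rw [hB, LinearEquiv.apply_symm_apply]
    -- `R(u)B` solves the rotated equation
    have hsol : deltaAEquiv η o Ω₀ (gaugeAct u U₀) hr' (rotD u Ω₀ B) = restrictLin Ω₀ (rotB u J) := by
      apply Subtype.ext
      rw [deltaAEquiv_coe, coe_rotD, deltaADom_gaugeAct η o Ω₀ h, restrictLin_coe, restrictDom_rotB]
      have hc := congrArg (fun C : domSub (𝔸 := 𝔸) Ω₀ => (C : Site d → Fin d → 𝔸)) hB'
      simp only [deltaAEquiv_coe, restrictLin_coe] at hc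
      rw [hc]
    have hs : (deltaAEquiv η o Ω₀ (gaugeAct u U₀) hr').symm (restrictLin Ω₀ (rotB u J)) = rotD u Ω₀ B := by
      rw [LinearEquiv.symm_apply_eq]
      exact hsol.symm
    rw [hs, coe_rotD]
  · have hr' : ¬ RegularAt η o Ω₀ (gaugeAct u U₀) := fun h1 => hr ((regularAt_gaugeAct_iff η o Ω₀ h h').1 h1)
    rw [gopZd_of_not_regularAt η o Ω₀ _ hr', gopZd_of_not_regularAt η o Ω₀ _ hr, map_zero]

/-- ★ **THE PAIRING `⟨A, Δ_a(U₀)A⟩_τ` IS AN ORBIT QUANTITY**: `⟨R(u)A, Δ_a(U₀^u)R(u)A⟩_τ = ⟨A, Δ_a(U₀)A⟩_τ` (`u` unitary, `τ` tracial, `Δ_a` covariant at `(U₀, u)`).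
[cite: Balaban1985BackgroundPropagators, (3.30) p.395, (3.34) p.396, Thm 3.11 p.416] -/
theorem bondPair_deltaAOf_gaugeAct (τ : 𝔸 →ₗ[ℂ] ℂ) (hτt : ∀ a b : 𝔸, τ (a * b) = τ (b * a)) (hu : ∀ z, u z ∈ unitaryUnits 𝔸)
    (h : LetterCovAt (deltaAOf η o) U₀ u) (A : Site d → Fin d → 𝔸) :
    bondPair τ (rotB u A) (deltaAOf η o (gaugeAct u U₀) (rotB u A)) = bondPair τ A (deltaAOf η o U₀ A) := by
  rw [h A, bondPair_rotB u τ hτt hu]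

/-- ★★ **POSITIVE-DEFINITENESS OF `Δ_a` ON `E(Ω₀)` PASSES ALONG THE ORBIT** («Δ_a(U) positive definite» may be checked in any gauge — in particular in the
small-field gauge (3.36) — and transported back): `u` unitary, `τ` tracial, `Δ_a` covariant at `(U₀, u)`.
[cite: Balaban1985BackgroundPropagators, Thm 3.11 p.416, (3.34)–(3.36) p.396] -/
theorem posDef_gaugeAct (τ : 𝔸 →ₗ[ℂ] ℂ) (hτt : ∀ a b : 𝔸, τ (a * b) = τ (b * a)) (hu : ∀ z, u z ∈ unitaryUnits 𝔸)
    (h : LetterCovAt (deltaAOf η o) U₀ u) (hpos : ∀ A ∈ domSub (𝔸 := 𝔸) Ω₀, A ≠ 0 → 0 < bondPair τ A (deltaAOf η o U₀ A)) :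
    ∀ A ∈ domSub (𝔸 := 𝔸) Ω₀, A ≠ 0 → 0 < bondPair τ A (deltaAOf η o (gaugeAct u U₀) A) := by
  intro A hA hA0
  have hA' : rotB u⁻¹ A ∈ domSub (𝔸 := 𝔸) Ω₀ := rotB_mem_domSub u⁻¹ hA
  have hA0' : rotB u⁻¹ A ≠ 0 := fun h0 => hA0 (by rw [← rotB_rotB_inv u A, h0, map_zero])
  have key := bondPair_deltaAOf_gaugeAct η o τ hτt hu h (rotB u⁻¹ A)
  rw [rotB_rotB_inv] at key
  rw [key]
  exact hpos _ hA' hA0'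

end Green

/-! ## §4  The genuine four-letter record `opsAllZd` at a member with finite `Ω₀`: all four letters covariant -/

section Record

variable [FiniteDimensional ℝ 𝔸] [Nontrivial 𝔸] (τ : 𝔸 →ₗ[ℂ] ℂ) (L : ℕ) (ΛbP : ℕ → ℕ → Set (Site d × Fin d))
  (ops₀ : ℝ → ZdIdx d L → ℕ → OpsZd d 𝔸) (M : ℝ) (i : ZdIdx d L) (m : ℕ) {u : Site d → 𝔸ˣ} {U₀ : Site d → Fin d → 𝔸ˣ}

/-- ★ **THE `Q*aQ` LETTER (EDITION P) IS COVARIANT** at every unitary `U₀` and unitary `u`, `2 ≤ L`, under the class's BOX clause at the levels `1 ≤ j`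
(EDITION P₀: print's class `cubeLamBP` with its level-0 crossing bonds is admitted) — the companion `…LevelZero.QQZdP_gaugeAct₀` in the `LetterCovAt` currency. [cite: Balaban1985BackgroundPropagators, (3.32) p.395, p.396 («the equalities (3.32) hold again»), (3.16) p.393] -/
theorem letterCovAt_QQZdP (hL : 2 ≤ L)
    (hbox : ∀ j, 1 ≤ j → j ≤ m → ∀ c ∈ ΛbP m j, ∀ x, InBox (loK L j c.1) (bondHiK L j c.1 c.2) x → x ∈ i.Ω (j - 1))
    (hτt : ∀ a b : 𝔸, τ (a * b) = τ (b * a)) (hτp : ∀ a : 𝔸, a ≠ 0 → 0 < (τ (star a * a)).re)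
    (hU₀ : ∀ x κ, U₀ x κ ∈ unitaryUnits 𝔸) (hu : ∀ z, u z ∈ unitaryUnits 𝔸) : LetterCovAt (QQZdP τ L ΛbP i m) U₀ u :=
  fun A => QQZdP_gaugeAct₀ τ hL hbox hτt hτp hU₀ hu A

omit [FiniteDimensional ℝ 𝔸] [Nontrivial 𝔸] in
/-- `U₀^u` is unitary-valued for unitary `U₀` and `u`. [cite: Balaban1985RegularSpaces, (1.1) p.76, p.77 (bookkeeping)] -/
theorem gaugeAct_mem_unitaryUnits' (hU₀ : ∀ x κ, U₀ x κ ∈ unitaryUnits 𝔸) (hu : ∀ z, u z ∈ unitaryUnits 𝔸) (x : Site d) (κ : Fin d) :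
    gaugeAct u U₀ x κ ∈ unitaryUnits 𝔸 :=
  Subgroup.mul_mem _ (Subgroup.mul_mem _ (hu x) (hU₀ x κ)) (Subgroup.inv_mem _ (hu _))

/-- ★★ **`Δ_a(U₀^u)(R(u)A) = R(u)Δ_a(U₀)A` FOR THE GENUINE RECORD `opsAllZd`, ALL FOUR LETTERS GENUINE** at a member with finite `Ω₀`: `τ` tracial, Hermitian,
faithful on a finite-dimensional fibre; `U₀` unitary, `u` unitary, `2 ≤ L`, the class's BOX clause (for the `Q*aQ` letter).
[cite: Balaban1985BackgroundPropagators, (3.34) p.396, (3.26) p.395, (3.30)–(3.33) pp.395–396] -/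
theorem letterCovAt_deltaAOf_opsAllZd (hL : 2 ≤ L)
    (hbox : ∀ j, 1 ≤ j → j ≤ m → ∀ c ∈ ΛbP m j, ∀ x, InBox (loK L j c.1) (bondHiK L j c.1 c.2) x → x ∈ i.Ω (j - 1))
    (hτt : ∀ a b : 𝔸, τ (a * b) = τ (b * a)) (hτs : ∀ a : 𝔸, τ (star a) = starRingEnd ℂ (τ a))
    (hτp : ∀ a : 𝔸, a ≠ 0 → 0 < (τ (star a * a)).re) (hU₀ : ∀ x κ, U₀ x κ ∈ unitaryUnits 𝔸) (hu : ∀ z, u z ∈ unitaryUnits 𝔸)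
    (hΩ : (i.Ω 0).Finite) :
    LetterCovAt (deltaAOf i.η (opsAllZd τ L ΛbP ops₀ M i m)) U₀ u := by
  refine letterCovAt_deltaAOf u U₀ i.η _ ?_ ?_ ?_
  · rw [opsAllZd_Dp]
    exact letterCovAt_DpZd u U₀ i.η
  · rw [opsAllZd_DRDs]
    exact letterCovAt_opsLandau_DRDs U₀ τ hτt hτs hτp hu _ M i m hΩ
  · rw [opsAllZd_QQ]
    exact letterCovAt_QQZdP τ L ΛbP i m hL hbox hτt hτp hU₀ hu

/-- ★★ **THE SAME WITHOUT THE BOX CLAUSE** for `U₀` in the class (1.7) on ALL of `ℤᵈ` (window `α_Q∕L²`; dag-n06-w2 g3's regime set `𝒰` of the per-member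
Theorem-3.11 road, `1 ∈ 𝒰`) — via the companion's `QQZdP_gaugeAct_of_reg17Univ`. [cite: Balaban1985BackgroundPropagators, (3.34) p.396, (3.26) p.395; Balaban1985RegularSpaces, (1.7) p.77] -/
theorem letterCovAt_deltaAOf_opsAllZd_of_reg17Univ (hL : 2 ≤ L)
    (hτt : ∀ a b : 𝔸, τ (a * b) = τ (b * a)) (hτs : ∀ a : 𝔸, τ (star a) = starRingEnd ℂ (τ a))
    (hτp : ∀ a : 𝔸, a ≠ 0 → 0 < (τ (star a * a)).re) (hU₀ : ∀ x κ, U₀ x κ ∈ unitaryUnits 𝔸)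
    (hregU : B9Eq316AveragingTransposeZd.Reg17 L m (fun _ => (Set.univ : Set (Site d))) (B9Eq316AveragingTransposeZd.alphaQ d L / (L : ℝ) ^ 2) U₀)
    (hu : ∀ z, u z ∈ unitaryUnits 𝔸) (hΩ : (i.Ω 0).Finite) :
    LetterCovAt (deltaAOf i.η (opsAllZd τ L ΛbP ops₀ M i m)) U₀ u := by
  refine letterCovAt_deltaAOf u U₀ i.η _ ?_ ?_ ?_
  · rw [opsAllZd_Dp]
    exact letterCovAt_DpZd u U₀ i.η
  · rw [opsAllZd_DRDs]
    exact letterCovAt_opsLandau_DRDs U₀ τ hτt hτs hτp hu _ M i m hΩ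
  · rw [opsAllZd_QQ]
    exact fun A => B9Eq332AveragingLetterCovarianceZd.QQZdP_gaugeAct_of_reg17Univ τ L hL hτt hτp hU₀ hregU hu A

/-- ★★★ **(3.34) FOR THE GENUINE RECORD: `G(U₀^u)(R(u)J) = R(u)(G(U₀)J)`** for `(opsAllZd τ L ΛbP ops₀ M i m).Gop` = dag-n06-w4's `(Ω₀Δ_aΩ₀)⁻¹` over the three
genuine co-letters, at a member with finite `Ω₀` — unitary `U₀`, unitary `u`, `2 ≤ L`, the class's BOX clause, `τ` tracial Hermitian faithful; EVERY bond
field `J`; NO regularity ∕ smallness hypothesis (in Theorem 3.11's regime both sides are the conjugated inverse, outside it both are `0`).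
[cite: Balaban1985BackgroundPropagators, (3.34) p.396, (3.27) p.395] -/
theorem gop_opsAllZd_gaugeAct (hL : 2 ≤ L)
    (hbox : ∀ j, 1 ≤ j → j ≤ m → ∀ c ∈ ΛbP m j, ∀ x, InBox (loK L j c.1) (bondHiK L j c.1 c.2) x → x ∈ i.Ω (j - 1))
    (hτt : ∀ a b : 𝔸, τ (a * b) = τ (b * a)) (hτs : ∀ a : 𝔸, τ (star a) = starRingEnd ℂ (τ a))
    (hτp : ∀ a : 𝔸, a ≠ 0 → 0 < (τ (star a * a)).re) (hU₀ : ∀ x κ, U₀ x κ ∈ unitaryUnits 𝔸) (hu : ∀ z, u z ∈ unitaryUnits 𝔸)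
    (hΩ : (i.Ω 0).Finite) (J : Site d → Fin d → 𝔸) :
    (opsAllZd τ L ΛbP ops₀ M i m).Gop (gaugeAct u U₀) (rotB u J) = rotB u ((opsAllZd τ L ΛbP ops₀ M i m).Gop U₀ J) := by
  rw [opsAllZd_Gop, opsAllZd_Gop]
  have h := letterCovAt_deltaAOf_opsAllZd τ L ΛbP ops₀ M i m hL hbox hτt hτs hτp hU₀ hu hΩ
  have h' := letterCovAt_deltaAOf_opsAllZd τ L ΛbP ops₀ M i m (u := u⁻¹) (U₀ := gaugeAct u U₀) hL hbox hτt hτs hτp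
    (gaugeAct_mem_unitaryUnits' hU₀ hu) (inv_mem_unitaryUnits hu) hΩ
  exact gopZd_gaugeAct i.η _ (i.Ω 0) h h' J

/-- `RegularAt` (Theorem 3.11's qualitative conclusion) for the genuine record is CONSTANT on the gauge orbit (same hypotheses).
[cite: Balaban1985BackgroundPropagators, (3.34) p.396, Thm 3.11 p.416, (3.35)–(3.36) p.396] -/
theorem regularAt_opsAllZd_gaugeAct_iff (hL : 2 ≤ L)
    (hbox : ∀ j, 1 ≤ j → j ≤ m → ∀ c ∈ ΛbP m j, ∀ x, InBox (loK L j c.1) (bondHiK L j c.1 c.2) x → x ∈ i.Ω (j - 1))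
    (hτt : ∀ a b : 𝔸, τ (a * b) = τ (b * a)) (hτs : ∀ a : 𝔸, τ (star a) = starRingEnd ℂ (τ a))
    (hτp : ∀ a : 𝔸, a ≠ 0 → 0 < (τ (star a * a)).re) (hU₀ : ∀ x κ, U₀ x κ ∈ unitaryUnits 𝔸) (hu : ∀ z, u z ∈ unitaryUnits 𝔸)
    (hΩ : (i.Ω 0).Finite) :
    RegularAt i.η (opsLandau τ (withDpZd (withQQP τ L ΛbP ops₀)) M i m) (i.Ω 0) (gaugeAct u U₀) ↔
      RegularAt i.η (opsLandau τ (withDpZd (withQQP τ L ΛbP ops₀)) M i m) (i.Ω 0) U₀ :=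
  regularAt_gaugeAct_iff i.η _ (i.Ω 0) (letterCovAt_deltaAOf_opsAllZd τ L ΛbP ops₀ M i m hL hbox hτt hτs hτp hU₀ hu hΩ)
    (letterCovAt_deltaAOf_opsAllZd τ L ΛbP ops₀ M i m (u := u⁻¹) (U₀ := gaugeAct u U₀) hL hbox hτt hτs hτp
      (gaugeAct_mem_unitaryUnits' hU₀ hu) (inv_mem_unitaryUnits hu) hΩ)

/-- ★★ **POSITIVE-DEFINITENESS OF THE GENUINE `Δ_a` ON `E(Ω₀)` PASSES FROM `U₀` TO `U₀^u`** (the transport half of the per-member Theorem-3.11 road: with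
dag-n06-b's flat positivity `flat_posDef_herm_cube` and dag-n06-w4's openness `B9Thm311PosDefOpenZd` it carries positivity from a neighbourhood of `U₀ = 1` to a
neighbourhood of every PURE GAUGE `1^u`). [cite: Balaban1985BackgroundPropagators, Thm 3.11 p.416, (3.34)–(3.36) p.396] -/
theorem posDef_opsAllZd_gaugeAct (hL : 2 ≤ L)
    (hbox : ∀ j, 1 ≤ j → j ≤ m → ∀ c ∈ ΛbP m j, ∀ x, InBox (loK L j c.1) (bondHiK L j c.1 c.2) x → x ∈ i.Ω (j - 1))
    (hτt : ∀ a b : 𝔸, τ (a * b) = τ (b * a)) (hτs : ∀ a : 𝔸, τ (star a) = starRingEnd ℂ (τ a))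
    (hτp : ∀ a : 𝔸, a ≠ 0 → 0 < (τ (star a * a)).re) (hU₀ : ∀ x κ, U₀ x κ ∈ unitaryUnits 𝔸) (hu : ∀ z, u z ∈ unitaryUnits 𝔸)
    (hΩ : (i.Ω 0).Finite)
    (hpos : ∀ A ∈ domSub (𝔸 := 𝔸) (i.Ω 0), A ≠ 0 → 0 < bondPair τ A (deltaAOf i.η (opsAllZd τ L ΛbP ops₀ M i m) U₀ A)) :
    ∀ A ∈ domSub (𝔸 := 𝔸) (i.Ω 0), A ≠ 0 → 0 < bondPair τ A (deltaAOf i.η (opsAllZd τ L ΛbP ops₀ M i m) (gaugeAct u U₀) A) :=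
  posDef_gaugeAct i.η _ (i.Ω 0) τ hτt hu (letterCovAt_deltaAOf_opsAllZd τ L ΛbP ops₀ M i m hL hbox hτt hτs hτp hU₀ hu hΩ) hpos

end Record

end Literature.MathematicalPhysics.QuantumFieldTheory.Balaban1983to89.B9Eq334GaugeCovarianceZd

end
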